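import Literature.Analysis.FluidPDE.Vorticity
import Literature.Analysis.FluidPDE.LocalTypeI
import HarnessLib

/-!
# Vorticity confined to a double cone forces local regularity (Lei–Ren–Tian 2025)

Topic `Analysis/FluidPDE`. Source: Z. Lei, X. Ren, G. Tian, *A geometric characterization of
potential Navier–Stokes singularities*, arXiv:2501.08976 (v1, January 2025) [LeiRenTian2025]
(an arXiv preprint at the time of vendoring; no journal version is known to us). Read in the
arXiv version: §1 (Theorem 1.1 with its footnote defining regular points, Remarks 1.2–1.4, the
sets `𝓘_{r,M}`, `𝓘` and Corollaries 1.5–1.6, pp. 4–5), §2.1 (the class of local suitable weak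
solutions, (2.1)–(2.2), p. 6), §3–§4 (proof of Theorem 1.1, pp. 8–12), §5 (proofs of the
corollaries, p. 13).

## The results, as printed

Let `Q(r) = B(r) × (-r², 0)` be the backward parabolic cylinders centred at the space–time
origin and let `(v, p)` be a *local suitable weak solution* of the unforced Navier–Stokes
equations `∂ₜv - Δv + v·∇v + ∇p = 0`, `∇·v = 0` in `Q(1)` (§2.1: finite local energies
`sup_{-1<t<0} ∫_{B(1)} |v|² + ∫_{Q(1)} |∇v|² + ∫_{Q(1)} |p|^{3/2} < ∞`, the equations in the sense
of distributions, and the local energy inequality). Write `ω = ∇ × v` and `ξ = ω/|ω|` (defined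
where `ω ≠ 0`). "We say that `(x,t)` is a regular point of `v` if `v` is bounded in a parabolic
cylinder centered at `(x,t)`" (footnote 1; the cylinders of the paper are the backward ones,
`Q(r; x₀, t₀) = {(x + x₀, t + t₀) : (x, t) ∈ Q(r)}`, §2).

* **Theorem 1.1.** Suppose that there exist a unit vector `e ∈ 𝕊²` and positive constants
  `δ, M` such that, for any regular point `(x,t) ∈ Q(1)` of `v`, there holds either
  `|ω(x,t)| ≤ M` or `|ξ(x,t) × e| ≤ 1 - δ`. Then `v` is regular in `\overline{Q(1/2)}`.
  (`LeiRenTian2025_doubleCone_regularity`.)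
* **Corollary 1.5.** With `𝓘_{r,M} = {ξ(x,t) : v is regular at (x,t) ∈ Q(r), |ω(x,t)| > M}`
  and `𝓘 = ⋂_{0<r<1} ⋂_{M>0} \overline{𝓘_{r,M}} ⊆ 𝕊²`: `𝓘` intersects every great circle of
  `𝕊²` if and only if the origin is a singular point. (`LeiRenTian2025.directionSet`,
  `LeiRenTian2025.limitDirectionSet`, `LeiRenTian2025_limitDirectionSet_iff`.)
* **Corollary 1.6.** Suppose that for some `δ > 0`, `|ξ(x,t) × ξ(y,t)| < 1 - δ` for any pair of
  regular points `(x,t), (y,t) ∈ Q(1)` with `|ω(x,t)| · |ω(y,t)| ≠ 0`. Then `v` is regular at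
  the origin. (`LeiRenTian2025_pairwiseDirection_regularity`.)

Mechanism of the proof (§§3–4, not vendored): under the cone condition the flipped vorticity
`ω sgn(ω·e)` is (almost) divergence free, so the absolute vorticity flux through horizontal
discs `Γ(r, z, t) = ∫_{D(r,z)} |ω₃|` is a bounded, dimensionless quantity (Lemma 3.1), which
yields uniform Type I bounds (Lemma 3.2, via Seregin–Šverák); a De Giorgi–Nash–Moser oscillation
argument on the quantitative shells of regularity of Lei–Ren then forces local smallness of the
flux for the blow-up limit and hence `ε`-regularity (§4).

## Transcription into the tree's vocabulary

* Space–time is `ℝ × ℝ³`, **time first**, `ℝ³ = EuclideanSpace ℝ (Fin 3)`; `Q(r)` is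
  `parabolicCylinder r (0 : ℝ × ℝ³) = (-r², 0) × B_r(0)` (`SuitableWeak.lean`).
* *Local suitable weak solution in `Q(1)`* (§2.1, (2.1)–(2.2)) = the accepted
  `IsSuitableWeakSolutionInBall 1 0 u p` (`LocalTypeI.lean`; Albritton–Barker 2019, Def. 2.1):
  the local notion `IsSuitableWeakSolutionOn (parabolicCylinderOpens 1 0) 1 0 u p` (unit
  viscosity, zero force, distributional equations, local energy inequality against
  `C_c^∞(Q(1))`) together with exactly the global integrability class (2.1) on `Q(1)`
  (`esssup_t ∫_{B(1)} |v|² < ∞`, `∇v ∈ L²(Q(1))` through a weak spatial gradient,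
  `p ∈ L^{3/2}(Q(1))`). The paper's time-slice form (2.2) of the local energy inequality and
  the integrated form agree given the global class (CKN 1982, §2; see the docstring of
  `IsSuitableWeakSolutionInBall`).
* *Regular / singular points* (footnote 1, backward cylinders with vertex at the point) =
  `¬ IsBackwardSingularPoint u z` / `IsBackwardSingularPoint u z` (`LocalTypeI.lean`,
  Albritton–Barker's wording of the same notion; `not_isBackwardSingularPoint_iff` unfolds it to
  "`u` is essentially bounded on some `Q(z, r)`, `r > 0`"). This is the notion used both in the
  hypotheses ("for any regular point `(x,t) ∈ Q(1)`") and in the conclusions ("regular in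
  `\overline{Q(1/2)}`", "regular at the origin" — points of the top lid `t = 0`, where only the
  backward notion makes sense for a solution living on `Q(1)`). It is *not* replaced by the
  centred `IsRegularPoint` of `SuitableWeak.lean`.
* *`ω(x,t)`, `ξ(x,t)` at a regular point* are the pointwise `curl (u t) x` and
  `vorticityDirection (curl (u t)) x = ‖ω‖⁻¹ • ω` (`Vorticity.lean`; junk value `0` where
  `ω = 0`, harmless: there `|ω| ≤ M` holds anyway, and Cor. 1.6 / `𝓘_{r,M}` only look at
  `ω ≠ 0`); `|a × b|` is `‖cross a b‖` (`VectorCalculus.lean`).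
* **Choice of representative (`LeiRenTian2025.IsClassicalAtRegularPoints`).** In Lean `u` is an
  everywhere-defined function, i.e. a *representative* of the solution class, while the paper's
  `ω(x,t)` at a regular point is the vorticity of the canonical representative, which is smooth
  on the (relatively open) regular set (Serrin 1962; CKN 1982, §6). A pointwise hypothesis on
  `curl (u t) x` for an *arbitrary* representative would be vacuous (modifying `u` on the null
  set `ℝ × ℚ³` makes every slice nowhere differentiable, so that `curl (u t) x = 0` is the junk
  value everywhere, while all integral conditions are unchanged) and the "facts" below would then
  assert the regularity of every local suitable weak solution. The statements therefore carry
  the standing hypothesis that `u` is, at every regular point `z = (t,x) ∈ Q(1)`, jointly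
  continuous at `z` and differentiable in space at `x` — true for the canonical representative,
  and pinning `u` down to it on the regular set (two continuous functions that agree a.e. on an
  open set agree everywhere on it), so that `curl (u t) x` there is the classical vorticity of
  the paper. For smooth solutions (mild bounded ancient solutions, Leray–Hopf solutions before a
  first blow-up time) this hypothesis is free.
* Great circles of `𝕊²`: `{ξ : ‖ξ‖ = 1, ⟪ξ, e⟫ = 0}` for unit `e`; the closure
  `\overline{𝓘_{r,M}}` "in `𝕊²`" is the closure in `ℝ³` (`𝓘_{r,M} ⊆ 𝕊²`, a closed set:
  `LeiRenTian2025.directionSet_subset_sphere`).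

## Deliberately not here

Remark 2.1's variants with the flat cylinders `𝓑(r), 𝓠(r)`; Lemmas 2.3–2.5, 3.1–3.2 and the
`Γ`-supersolution inequality of §4 (tools of the proof); Proposition 6.1 (direction of the
velocity, axisymmetric case); the rotated form of Remark 1.2 (`|ω_h| ≤ C|ω₃|`).

## Mathlib / tree search

`lean search 'LeiRenTian|doubleCone|2501.08976'`: no declarations (2026-08-16). Reused from the
tree: `parabolicCylinder`, `IsSuitableWeakSolutionInBall`, `IsBackwardSingularPoint`, `curl`,
`cross`, `vorticityDirection`, `norm_vorticityDirection`.

## References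

* Z. Lei, X. Ren, G. Tian, *A geometric characterization of potential Navier–Stokes
  singularities*, arXiv:2501.08976 [math.AP] (2025): Thm. 1.1, footnote 1, Rmk. 1.2–1.4,
  Cor. 1.5–1.6 (pp. 4–5), §2.1 (2.1)–(2.2) (p. 6), §§3–5 (pp. 8–13). [LeiRenTian2025]
* D. Albritton, T. Barker, *On local Type I singularities of the Navier–Stokes equations and
  Liouville theorems*, J. Math. Fluid Mech. 21 (2019), Def. 2.1 and §1 (backward singular
  points). [AlbrittonBarker2019]
* L. Caffarelli, R. Kohn, L. Nirenberg, *Partial regularity of suitable weak solutions of the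
  Navier–Stokes equations*, Comm. Pure Appl. Math. 35 (1982), §2, §6. [CaffarelliKohnNirenberg1982]
-/

noncomputable section

open MeasureTheory Set Function Filter Metric
open scoped InnerProductSpace RealInnerProductSpace ENNReal NNReal Topology

namespace Literature.Analysis.FluidPDE

/-- Local notation for physical space `ℝ³ = EuclideanSpace ℝ (Fin 3)`. -/
local notation "ℝ³" => EuclideanSpace ℝ (Fin 3)

/-! ### Regular points in the backward sense -/

/-- A space–time point is *regular* in the sense of Lei–Ren–Tian's footnote 1 ("`v` is bounded
in a parabolic cylinder centered at `(x,t)`", backward cylinders `Q(z, r) = (t - r², t) × B_r(x)`)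
iff it is not a backward singular point in the sense of Albritton–Barker: `u` is essentially
bounded on some `Q(z, r)`, `r > 0`. [folklore] -/
theorem not_isBackwardSingularPoint_iff {u : ℝ → ℝ³ → ℝ³} {z : ℝ × ℝ³} :
    ¬ IsBackwardSingularPoint u z ↔
      ∃ r : ℝ, 0 < r ∧
        eLpNorm (uncurry u) ∞ (volume.restrict (parabolicCylinder r z)) < ∞ := by
  simp only [IsBackwardSingularPoint, not_forall, exists_prop, lt_top_iff_ne_top]

namespace LeiRenTian2025

/-- **Representative convention** for pointwise vorticity hypotheses on a (local suitable) weak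
solution `u` in a space–time region `Q`: at every regular point `z = (t, x) ∈ Q` (backward sense,
`¬ IsBackwardSingularPoint u z`) the function `u` is jointly continuous at `z` and `u(t, ·)` is
differentiable at `x`. This holds for the canonical representative, which is smooth on the regular
set (Serrin 1962; Caffarelli–Kohn–Nirenberg 1982, §6), and it pins `u` down to that representative
there, so that `curl (u t) x` is the classical vorticity `ω(x,t)` of Lei–Ren–Tian 2025, Thm. 1.1
(see the module docstring, *Choice of representative*). [folklore] -/
def IsClassicalAtRegularPoints (u : ℝ → ℝ³ → ℝ³) (Q : Set (ℝ × ℝ³)) : Prop :=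
  ∀ z ∈ Q, ¬ IsBackwardSingularPoint u z →
    ContinuousAt (uncurry u) z ∧ DifferentiableAt ℝ (u z.1) z.2

/-- A function that is jointly continuous and slice-wise differentiable everywhere (e.g. a smooth
velocity field) satisfies the representative convention on every region. [folklore] -/
theorem IsClassicalAtRegularPoints.of_continuous_of_differentiable {u : ℝ → ℝ³ → ℝ³}
    (hc : Continuous (uncurry u)) (hd : ∀ t, Differentiable ℝ (u t)) (Q : Set (ℝ × ℝ³)) :
    IsClassicalAtRegularPoints u Q :=
  fun z _ _ => ⟨hc.continuousAt, (hd z.1) z.2⟩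

/-- The representative convention is monotone in the region. [folklore] -/
theorem IsClassicalAtRegularPoints.mono {u : ℝ → ℝ³ → ℝ³} {Q Q' : Set (ℝ × ℝ³)}
    (h : IsClassicalAtRegularPoints u Q) (hQ : Q' ⊆ Q) : IsClassicalAtRegularPoints u Q' :=
  fun z hz => h z (hQ hz)

/-! ### The sets `𝓘_{r,M}` and `𝓘` of high-vorticity directions (Lei–Ren–Tian 2025, §1) -/

/-- Lei–Ren–Tian's set of **high-vorticity directions**
`𝓘_{r,M} = {ξ(x,t) : v is regular at (x,t) ∈ Q(r), |ω(x,t)| > M} ⊆ 𝕊²` of a velocity field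
`u` on the backward cylinder `Q(r) = (-r², 0) × B_r(0)` (arXiv:2501.08976, §1, display before
Cor. 1.5): the vorticity directions `ξ = ω/|ω|`, `ω(x,t) = curl (u t) x`, at the regular points
(backward sense) of `Q(r)` where `|ω| > M`. Meant for `0 < r` and `0 < M` and for a `u`
satisfying the representative convention `IsClassicalAtRegularPoints u (Q(1))`.
[cite: LeiRenTian2025, §1 (definition of 𝓘_{r,M} before Cor. 1.5, arXiv p. 4)] -/
def directionSet (u : ℝ → ℝ³ → ℝ³) (r M : ℝ) : Set ℝ³ :=
  (fun z : ℝ × ℝ³ => vorticityDirection (curl (u z.1)) z.2) ''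
    {z | z ∈ parabolicCylinder r (0 : ℝ × ℝ³) ∧ ¬ IsBackwardSingularPoint u z ∧
      M < ‖curl (u z.1) z.2‖}

/-- Lei–Ren–Tian's **limit set of high-vorticity directions at the origin**,
`𝓘 = ⋂_{0<r<1} ⋂_{M>0} \overline{𝓘_{r,M}} ⊆ 𝕊²` (arXiv:2501.08976, §1, display before Cor. 1.5;
the closure in `𝕊²` equals the closure in `ℝ³` since `𝓘_{r,M} ⊆ 𝕊²` is contained in a closed
set). "If the origin is a regular point of `v`, then it is clear that `𝓘 = ∅`."
[cite: LeiRenTian2025, §1 (definition of 𝓘 before Cor. 1.5, arXiv p. 4)] -/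
def limitDirectionSet (u : ℝ → ℝ³ → ℝ³) : Set ℝ³ :=
  ⋂ r ∈ Ioo (0 : ℝ) 1, ⋂ M ∈ Ioi (0 : ℝ), closure (directionSet u r M)

variable {u : ℝ → ℝ³ → ℝ³} {r M : ℝ}

/-- Membership in `𝓘_{r,M}`, unfolded. [folklore] -/
theorem mem_directionSet {ξ : ℝ³} :
    ξ ∈ directionSet u r M ↔ ∃ z : ℝ × ℝ³, z ∈ parabolicCylinder r (0 : ℝ × ℝ³) ∧
      ¬ IsBackwardSingularPoint u z ∧ M < ‖curl (u z.1) z.2‖ ∧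
      vorticityDirection (curl (u z.1)) z.2 = ξ := by
  simp only [directionSet, mem_image, mem_setOf_eq]
  constructor
  · rintro ⟨z, ⟨hz, hreg, hM⟩, rfl⟩
    exact ⟨z, hz, hreg, hM, rfl⟩
  · rintro ⟨z, hz, hreg, hM, rfl⟩
    exact ⟨z, ⟨hz, hreg, hM⟩, rfl⟩

/-- `𝓘_{r,M} ⊆ 𝕊²` for `M ≥ 0`: the directions are unit vectors (`|ω| > M ≥ 0`, so `ω ≠ 0` and
`‖ω/|ω|‖ = 1`). [folklore] -/
theorem directionSet_subset_sphere (hM : 0 ≤ M) : directionSet u r M ⊆ sphere (0 : ℝ³) 1 := by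
  rintro ξ hξ
  obtain ⟨z, -, -, hMz, rfl⟩ := mem_directionSet.1 hξ
  have hne : curl (u z.1) z.2 ≠ 0 := fun h => by
    rw [h, norm_zero] at hMz
    exact (hM.trans_lt hMz).false
  rw [mem_sphere_zero_iff_norm]
  exact norm_vorticityDirection _ hne

/-- `𝓘_{r,M}` is antitone in the threshold `M`. [folklore] -/
theorem directionSet_anti_right {M M' : ℝ} (h : M ≤ M') :
    directionSet u r M' ⊆ directionSet u r M := by
  rintro ξ hξ
  obtain ⟨z, hz, hreg, hMz, rfl⟩ := mem_directionSet.1 hξ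
  exact mem_directionSet.2 ⟨z, hz, hreg, h.trans_lt hMz, rfl⟩

/-- `𝓘 ⊆ 𝕊²`. [folklore] -/
theorem limitDirectionSet_subset_sphere : limitDirectionSet u ⊆ sphere (0 : ℝ³) 1 := by
  intro ξ hξ
  have h : ξ ∈ closure (directionSet u (1 / 2) 1) := by
    simp only [limitDirectionSet, mem_iInter] at hξ
    exact hξ (1 / 2) ⟨by norm_num, by norm_num⟩ 1 (by norm_num : (0 : ℝ) < 1)
  exact (closure_minimal (directionSet_subset_sphere zero_le_one) isClosed_sphere) h

end LeiRenTian2025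

/-! ### The three results -/

/-- **Lei–Ren–Tian 2025, Theorem 1.1 (vorticity in a double cone where it is large ⇒ local
regularity).** Let `(u, p)` be a local suitable weak solution of the unforced Navier–Stokes
equations (`ν = 1`) in `Q(1) = (-1, 0) × B_1(0)` (`IsSuitableWeakSolutionInBall 1 0 u p`: the
paper's class (2.1)–(2.2)), represented so that `u` is jointly continuous and differentiable in
space at each of its regular points in `Q(1)` (`LeiRenTian2025.IsClassicalAtRegularPoints`, the
canonical representative; see the module docstring). Suppose there exist a unit vector `e` and
constants `δ > 0`, `M > 0` such that at every **regular** point `(t, x) ∈ Q(1)` (backward sense: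
`u` essentially bounded on some `Q((t,x), r)`), either `|ω(x,t)| ≤ M` or `|ξ(x,t) × e| ≤ 1 - δ`,
where `ω = curl u(t, ·)(x)` and `ξ = ω/|ω|` — i.e. wherever the vorticity is large its direction
lies in the double cone of half-angle `arcsin (1 - δ)` around `±e`. Then `u` is regular at every
point of the closed cylinder `\overline{Q(1/2)} = [-1/4, 0] × \overline{B_{1/2}(0)}`.
[cite: LeiRenTian2025, Thm. 1.1 (arXiv:2501.08976, p. 4; proof §§3–4, pp. 8–12)] -/
def LeiRenTian2025_doubleCone_regularity : Prop :=
  ∀ (u : ℝ → ℝ³ → ℝ³) (p : ℝ → ℝ³ → ℝ) (e : ℝ³) (δ M : ℝ),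
    IsSuitableWeakSolutionInBall 1 0 u p →
    LeiRenTian2025.IsClassicalAtRegularPoints u (parabolicCylinder 1 (0 : ℝ × ℝ³)) →
    ‖e‖ = 1 → 0 < δ → 0 < M →
    (∀ z ∈ parabolicCylinder 1 (0 : ℝ × ℝ³), ¬ IsBackwardSingularPoint u z →
      ‖curl (u z.1) z.2‖ ≤ M ∨
        ‖cross (vorticityDirection (curl (u z.1)) z.2) e‖ ≤ 1 - δ) →
    ∀ z ∈ closure (parabolicCylinder (1 / 2) (0 : ℝ × ℝ³)), ¬ IsBackwardSingularPoint u z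

/-- **Lei–Ren–Tian 2025, Corollary 1.5 (geometric characterization of singular points).** Let
`(u, p)` be a local suitable weak solution of the unforced Navier–Stokes equations in `Q(1)`
(`IsSuitableWeakSolutionInBall 1 0 u p`), represented canonically at its regular points
(`LeiRenTian2025.IsClassicalAtRegularPoints`). Then the limit set of high-vorticity directions
`𝓘 = ⋂_{0<r<1} ⋂_{M>0} \overline{𝓘_{r,M}}` (`LeiRenTian2025.limitDirectionSet u`) meets every
great circle `{ξ ∈ 𝕊² : ξ ⊥ e}`, `|e| = 1`, **if and only if** the origin is a singular point
(backward sense). ("If the origin is a regular point of `v`, then it is clear that `𝓘 = ∅`";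
the converse is Theorem 1.1 applied to a double cone avoiding a missed great circle, §5.)
[cite: LeiRenTian2025, Cor. 1.5 (arXiv:2501.08976, p. 4; proof §5, p. 13)] -/
def LeiRenTian2025_limitDirectionSet_iff : Prop :=
  ∀ (u : ℝ → ℝ³ → ℝ³) (p : ℝ → ℝ³ → ℝ),
    IsSuitableWeakSolutionInBall 1 0 u p →
    LeiRenTian2025.IsClassicalAtRegularPoints u (parabolicCylinder 1 (0 : ℝ × ℝ³)) →
    ((∀ e : ℝ³, ‖e‖ = 1 →
        (LeiRenTian2025.limitDirectionSet u ∩ {ξ | ‖ξ‖ = 1 ∧ ⟪ξ, e⟫_ℝ = 0}).Nonempty) ↔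
      IsBackwardSingularPoint u (0 : ℝ × ℝ³))

/-- **Lei–Ren–Tian 2025, Corollary 1.6 (angles between simultaneous vorticity directions
uniformly away from `π/2` ⇒ regularity).** Let `(u, p)` be a local suitable weak solution of the
unforced Navier–Stokes equations in `Q(1)` (`IsSuitableWeakSolutionInBall 1 0 u p`), represented
canonically at its regular points (`LeiRenTian2025.IsClassicalAtRegularPoints`). Suppose that for
some `δ > 0`, `|ξ(x,t) × ξ(y,t)| < 1 - δ` for every pair of regular points `(t, x), (t, y) ∈ Q(1)`
at the same time with `ω(x,t) ≠ 0` and `ω(y,t) ≠ 0` (`ξ = ω/|ω|`, `ω = curl u(t,·)`). Then the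
origin is a regular point of `u` (backward sense: `u` is essentially bounded on some `Q(0, r)`).
The condition is required throughout `{|ω| > 0}`, not only where `|ω| > M` (the paper's remark
after Cor. 1.6). [cite: LeiRenTian2025, Cor. 1.6 (arXiv:2501.08976, p. 5; proof §5, p. 13)] -/
def LeiRenTian2025_pairwiseDirection_regularity : Prop :=
  ∀ (u : ℝ → ℝ³ → ℝ³) (p : ℝ → ℝ³ → ℝ) (δ : ℝ),
    IsSuitableWeakSolutionInBall 1 0 u p →
    LeiRenTian2025.IsClassicalAtRegularPoints u (parabolicCylinder 1 (0 : ℝ × ℝ³)) →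
    0 < δ →
    (∀ (t : ℝ) (x y : ℝ³), (t, x) ∈ parabolicCylinder 1 (0 : ℝ × ℝ³) →
      (t, y) ∈ parabolicCylinder 1 (0 : ℝ × ℝ³) →
      ¬ IsBackwardSingularPoint u (t, x) → ¬ IsBackwardSingularPoint u (t, y) →
      curl (u t) x ≠ 0 → curl (u t) y ≠ 0 →
      ‖cross (vorticityDirection (curl (u t)) x) (vorticityDirection (curl (u t)) y)‖ < 1 - δ) →
    ¬ IsBackwardSingularPoint u (0 : ℝ × ℝ³)

end Literature.Analysis.FluidPDE

end
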